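import Summits.Ventures.WeilGRH.ZetaWindowAtoms
import HarnessLib

/-!
# rh-explicit (venture WeilGRH): THE POLE TERM OF THE MODULATED FLAT WINDOW IN CLOSED FORM

Cell `rh-explicit`, WEIL TRACK (structure seat weil-3, gen10).  Companion of `ZetaWindowAtoms.lean` (which has
the even polar moment `∫ e^{iθx}χ_0 cosh(x/2)` exactly and the bound `P(e^{iθx}χ_0) ≤ 4(sinh²(a/2)+sin²(θa))/(a(¼+θ²))`).
Here the odd moment and the EXACT pole term of the explicit formula for the modulated pair `u_θ ⋆ ũ_θ`:

* `integral_modulated_chi_zero_mul_sinh`: `∫ e^{iθx}χ_0(x) sinh(x/2) dx = i(cosh(a/2)sin θa − 2θ sinh(a/2)cos θa)/((¼+θ²)√(2a))`;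
* **`weilPoleForm_modulated_chi_zero`**:
  `P(e^{iθx}χ_0) = [(sinh(a/2)cos θa + 2θ cosh(a/2)sin θa)² − (cosh(a/2)sin θa − 2θ sinh(a/2)cos θa)²] / (a(¼+θ²)²)`
  (`= 16 sinh²(a/2)/a` at `θ = 0`; even in `θ`; for large `a` this is `~ Re[e^{(1+2iθ)a}/((½+iθ)²a)]`, the main
  term of the explicit formula for `Σ_{n<e^{2a}}Λ(n)n^{-1/2-iθ}(1 − log n/(2a))`);
* **`weilWindowForm_modulated_chi_zero_explicit`**: the whole `ζ` window form of `e^{iθx}χ_0` — hence the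
  one-window multiplicity certificate of `ZetaWindowAtoms` / `ZetaWindowAtomsLimit` — as an explicit real number
  (pole term above, `2Σ_{log n<2a}Λ(n)n^{-1/2}(1 − log n/(2a))cos(θ log n)`, `K₀`, and the archimedean cost
  `∫₀^∞ρ(t)(2(1 − cos θt) + cos(θt)min(t,2a)/a)dt`).

No definitions, no named facts; RH-free.
-/

set_option autoImplicit false

noncomputable section

open Complex Filter Set MeasureTheory
open scoped Real Topology ComplexConjugate ArithmeticFunction.vonMangoldt

namespace Summit.Ventures.WeilGRH

open Literature.NumberTheory.LFunctions
open Literature.NumberTheory.LFunctions.Yoshida1992 (chi chiCore)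
open Summit.RiemannHypothesis.RiemannHypothesis.Theorems.WeilFormatC

variable {a : ℝ}

/-- **The odd polar moment of the modulated flat window** (`a > 0`, `θ ∈ ℝ`):
`∫ e^{iθx}χ_0(x) sinh(x/2) dx = i (cosh(a/2)sin(θa) − 2θ sinh(a/2)cos(θa)) / ((¼+θ²)√(2a))` — purely imaginary. -/
theorem integral_modulated_chi_zero_mul_sinh (ha : 0 < a) (θ : ℝ) :
    ∫ x, cexp (I * (θ * x : ℝ)) * chi a 0 x * (Real.sinh (x / 2) : ℂ) =
      (((Real.cosh (a / 2) * Real.sin (θ * a) - 2 * θ * Real.sinh (a / 2) * Real.cos (θ * a)) /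
        ((1 / 4 + θ ^ 2) * Real.sqrt (2 * a)) : ℝ) : ℂ) * I := by
  set cp : ℂ := (((1 / 2 : ℝ) : ℂ) + θ * I) with hcp
  set cm : ℂ := (((-(1 / 2) : ℝ) : ℂ) + θ * I) with hcm
  have hcp0 : cp ≠ 0 := by
    intro h; have := congrArg Complex.re h; simp [hcp] at this
  have hcm0 : cm ≠ 0 := by
    intro h; have := congrArg Complex.re h; simp [hcm] at this
  have hpt : (fun x : ℝ ↦ cexp (I * (θ * x : ℝ)) * chi a 0 x * (Real.sinh (x / 2) : ℂ)) =
      fun x ↦ ((1 / 2 : ℝ) : ℂ) * (chi a 0 x * cexp (cp * x) - chi a 0 x * cexp (cm * x)) := by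
    funext x
    have e1 : cexp (cp * x) = cexp (I * (θ * x : ℝ)) * cexp ((x : ℂ) / 2) := by
      rw [← Complex.exp_add]; congr 1; rw [hcp]; push_cast; ring
    have e2 : cexp (cm * x) = cexp (I * (θ * x : ℝ)) * cexp (-((x : ℂ) / 2)) := by
      rw [← Complex.exp_add]; congr 1; rw [hcm]; push_cast; ring
    rw [e1, e2, Complex.ofReal_sinh, Complex.sinh]
    push_cast
    ring
  rw [hpt, integral_const_mul, integral_sub (integrable_chi_mul 0 (by fun_prop)) (integrable_chi_mul 0 (by fun_prop)),
    integral_chi_zero_mul_cexp ha hcp0, integral_chi_zero_mul_cexp ha hcm0]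
  rw [hcp, hcm, cexp_add_mul_I_mul_ofReal, cexp_neg_add_mul_I_mul_ofReal, cexp_add_mul_I_mul_ofReal,
    cexp_neg_add_mul_I_mul_ofReal]
  have e1 : (1 / 2 : ℝ) * a = a / 2 := by ring
  have e2 : (-(1 / 2) : ℝ) * a = -(a / 2) := by ring
  rw [e1, e2, neg_neg]
  rw [Real.sinh_eq, Real.cosh_eq]
  have h1 : (1 / 2 : ℝ) * (1 / 2) + θ * θ ≠ 0 := (by nlinarith [mul_self_nonneg θ] : (0 : ℝ) < _).ne'
  have h2 : (-(1 / 2) : ℝ) * (-(1 / 2)) + θ * θ ≠ 0 := (by nlinarith [mul_self_nonneg θ] : (0 : ℝ) < _).ne'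
  have h3 : Real.sqrt (2 * a) ≠ 0 := (Real.sqrt_pos.2 (by linarith)).ne'
  have h4 : (1 / 4 + θ ^ 2 : ℝ) ≠ 0 := by positivity
  apply Complex.ext
  · simp only [Complex.mul_re, Complex.add_re, Complex.sub_re, Complex.div_re, Complex.ofReal_re,
      Complex.ofReal_im, Complex.mul_im, Complex.add_im, Complex.sub_im, Complex.div_im, Complex.I_re,
      Complex.I_im, Complex.normSq_apply, mul_zero, zero_mul, sub_zero, add_zero, mul_one, zero_add]
    field_simp
    ring
  · simp only [Complex.mul_re, Complex.add_re, Complex.sub_re, Complex.div_re, Complex.ofReal_re,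
      Complex.ofReal_im, Complex.mul_im, Complex.add_im, Complex.sub_im, Complex.div_im, Complex.I_re,
      Complex.I_im, Complex.normSq_apply, mul_zero, zero_mul, sub_zero, add_zero, mul_one, zero_add]
    field_simp
    ring

/-! ## The pole term of the modulated window -/

/-- **THE POLE FORM OF THE MODULATED FLAT WINDOW, IN CLOSED FORM** (`a > 0`, `θ ∈ ℝ`):

  `P(e^{iθx}χ_0) = [(sinh(a/2)cos θa + 2θ cosh(a/2)sin θa)² − (cosh(a/2)sin θa − 2θ sinh(a/2)cos θa)²] / (a(¼+θ²)²)`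

(`= 16 sinh²(a/2)/a` at `θ = 0`, `ZetaFlatTest.weilPoleForm_chi_zero`; even in `θ`).  This is the polar term
`k̂(0) + k̂(1)` of the explicit formula for the pair `k = u_θ ⋆ ũ_θ`. -/
theorem weilPoleForm_modulated_chi_zero (ha : 0 < a) (θ : ℝ) :
    weilPoleForm (fun x ↦ cexp (I * (θ * x : ℝ)) * chi a 0 x) =
      ((Real.sinh (a / 2) * Real.cos (θ * a) + 2 * θ * Real.cosh (a / 2) * Real.sin (θ * a)) ^ 2 -
          (Real.cosh (a / 2) * Real.sin (θ * a) - 2 * θ * Real.sinh (a / 2) * Real.cos (θ * a)) ^ 2) /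
        (a * (1 / 4 + θ ^ 2) ^ 2) := by
  unfold weilPoleForm
  rw [integral_modulated_chi_zero_mul_cosh ha θ, integral_modulated_chi_zero_mul_sinh ha θ, norm_mul,
    Complex.norm_I, mul_one, Complex.norm_real, Complex.norm_real, Real.norm_eq_abs, Real.norm_eq_abs, sq_abs,
    sq_abs]
  have h3 : Real.sqrt (2 * a) ≠ 0 := (Real.sqrt_pos.2 (by linarith)).ne'
  have h4 : (1 / 4 + θ ^ 2 : ℝ) ≠ 0 := by positivity
  have h5 : Real.sqrt (2 * a) ^ 2 = 2 * a := Real.sq_sqrt (by linarith)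
  rw [div_pow, div_pow, mul_pow, h5]
  field_simp


/-- **THE `ζ` WINDOW FORM OF THE MODULATED FLAT WINDOW, EXPLICITLY** (`a > 0`, `θ ∈ ℝ`). -/
theorem weilWindowForm_modulated_chi_zero_explicit (ha : 0 < a) (θ : ℝ) :
    weilWindowForm a (fun x ↦ cexp (I * (θ * x : ℝ)) * chi a 0 x) =
      ((Real.sinh (a / 2) * Real.cos (θ * a) + 2 * θ * Real.cosh (a / 2) * Real.sin (θ * a)) ^ 2 -
          (Real.cosh (a / 2) * Real.sin (θ * a) - 2 * θ * Real.sinh (a / 2) * Real.cos (θ * a)) ^ 2) /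
        (a * (1 / 4 + θ ^ 2) ^ 2) -
        (2 * (∑ n ∈ weilPrimeIndex a, (Λ n : ℝ) / Real.sqrt n *
              ((1 - Real.log n / (2 * a)) * Real.cos (θ * Real.log n))) +
          (Real.log (4 * π) + Real.eulerMascheroniConstant +
            2 * ∫ t in Ioi (0 : ℝ), (Real.exp (t / 2) - 1) / (2 * Real.sinh t)) -
          ∫ t in Ioi (0 : ℝ), weilArchDensity t *
            (2 * (1 - Real.cos (θ * t)) + Real.cos (θ * t) * (min t (2 * a) / a))) := by
  rw [weilWindowForm_modulated_chi_zero ha, weilPoleForm_modulated_chi_zero ha]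

/-- The pole term is EVEN in the height: `P(e^{−iθx}χ_0) = P(e^{iθx}χ_0)`. -/
theorem weilPoleForm_modulated_chi_zero_neg (ha : 0 < a) (θ : ℝ) :
    weilPoleForm (fun x ↦ cexp (I * ((-θ) * x : ℝ)) * chi a 0 x) =
      weilPoleForm (fun x ↦ cexp (I * (θ * x : ℝ)) * chi a 0 x) := by
  rw [weilPoleForm_modulated_chi_zero ha, weilPoleForm_modulated_chi_zero ha, neg_mul, Real.cos_neg, Real.sin_neg]
  ring

end Summit.Ventures.WeilGRH

end
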